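import Summits.Schanuel.Schanuel.Theorems.RootDecomp1KMeasuredWallCell04

/-!
# RootDecomp1KMeasuredWallCell — lens 1, generation 38 «MEASURED WALL CELL of 33364» (the mixed wall (1, ℓ₂, ℓ₃, ρ) for every ρ in the tree class LogHyperLiouville) — continuation (RootDecomp1KMeasuredWallCell05): §5 the measured wall cells `sb_measuredWallCell (hNW) (hρ)`, `_pi`, `finiteOrderLiouvilleSchanuel_measuredWallCell (hNW) (hρ : LogHyperLiouville ρ)` (item binders verbatim + one range line), `_pi`, `InMeasuredWallClass(Pi)`, `_of_inMeasuredWallClass(Pi)`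

(lens-1 g38 `RootDecomp1KMeasuredWallCell.lean` [HOME/decomp-schanuel-lens-1/g38/RootDecomp1KMeasuredWallCell.lean sha256 168ec8e8…3303, 1895 l + MWprobe 0edab326… + MWctrl b192be9d… + NODE-g38.md 03a7462f…; NOTE/CLAIM L1764, ACK + CHECKLIST K-g38 L1782, NODE L1785 / REQUEST L1786 / RESULT L1787; writer re-check L1790]; port by census-1 gen 16 in seven parts
`RootDecomp1KMeasuredWallCell01`–`07` — see the PORT NOTE of part 01; `--supports stmt-Schanuel-33364`; rung 0.)
-/

noncomputable section

open Complex IntermediateField Polynomial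
open Summit.Schanuel.Schanuel.Theorems.RootDecomp1KHyper
open Summit.Schanuel.Schanuel.Theorems.RootDecomp1KHyper.HyperCell
open Summit.Schanuel.Schanuel.Theorems.RootDecomp1KGeneric
open Summit.Schanuel.Schanuel.Theorems.RootDecomp1KRelLiouvilleCell
open Summit.Schanuel.Schanuel.Theorems.RootDecomp1KLogLogCell (LogLogLiouville logLogLiouville_of_logHyperLiouville)
open Summit.Schanuel.Schanuel.Theorems.RootDecomp1KTwoBaseCell

namespace Summit.Schanuel.Schanuel.Theorems.RootDecomp1KMeasuredWallCell

open LiouvilleNumber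
open scoped Nat

/-! ## §5  The MEASURED WALL CELLS against item 33364 (`ρ` un-pinned: class data `LogHyperLiouville ρ` only) -/

section Cells
open LiouvilleNumber
open scoped Nat

/-- **Schanuel's bound on the measured wall cell, e-version** (mod the Nesterenko–Waldschmidt measure of `e`,
`hNW : NWMeasure`, verbatim `Literature.…NesterenkoWaldschmidt1996_thm_4_2`, tree-PROVED as
`NesterenkoWaldschmidt1996_thm_4_2_holds`): for EVERY log-hyper-Liouville real `ρ`,
`trdeg ℚ(1, ℓ₂, ℓ₃, ρ, e, e^{ℓ₂}, e^{ℓ₃}, e^ρ) ≥ 4`.  The join: the BLOCK MEASURE of `(ℓ₂, ℓ₃, e)` (§4) feeds the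
tree extraction `sb_of_logHyperLiouville_of_logPowMeasure` (g34) with `ρ` extracted LAST. -/
theorem sb_measuredWallCell (hNW : NWMeasure) {ρ : ℝ} (hρ : LogHyperLiouville ρ) :
    SB 4 ![(1 : ℂ), ((liouvilleNumber 2 : ℝ) : ℂ), ((liouvilleNumber 3 : ℝ) : ℂ), (ρ : ℂ)] := by
  refine sb_of_logHyperLiouville_of_logPowMeasure (n := 3) hρ ?_
    (logPowMeasure_two_three_exp_one hNW) ?_
  · exact subset_adjoin ℚ _ (Or.inl (Or.inl ⟨3, rfl⟩))
  · intro j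
    fin_cases j
    · exact subset_adjoin ℚ _ (Or.inl (Or.inl ⟨1, rfl⟩))
    · exact subset_adjoin ℚ _ (Or.inl (Or.inl ⟨2, rfl⟩))
    · exact subset_adjoin ℚ _ (Or.inl (Or.inr ⟨0, rfl⟩))

/-- **Schanuel's bound on the measured wall cell, π-version — HYPOTHESIS-FREE** (the measure of `π` is
tree-proved, `polyMeasure_pi`): for every log-hyper-Liouville real `ρ`,
`trdeg ℚ(π, πℓ₂, πℓ₃, πρ, e^π, e^{πℓ₂}, e^{πℓ₃}, e^{πρ}) ≥ 4`. -/
theorem sb_measuredWallCell_pi {ρ : ℝ} (hρ : LogHyperLiouville ρ) :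
    SB 4 ![(Real.pi : ℂ), (Real.pi : ℂ) * ((liouvilleNumber 2 : ℝ) : ℂ),
      (Real.pi : ℂ) * ((liouvilleNumber 3 : ℝ) : ℂ), (Real.pi : ℂ) * (ρ : ℂ)] := by
  set z : Fin 4 → ℂ := ![(Real.pi : ℂ), (Real.pi : ℂ) * ((liouvilleNumber 2 : ℝ) : ℂ),
      (Real.pi : ℂ) * ((liouvilleNumber 3 : ℝ) : ℂ), (Real.pi : ℂ) * (ρ : ℂ)] with hz
  have hπ0 : (Real.pi : ℂ) ≠ 0 := by exact_mod_cast Real.pi_ne_zero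
  have hz0 : z 0 ∈ adjoin ℚ (SFset z ∪ {I}) := subset_adjoin ℚ _ (Or.inl (Or.inl ⟨0, rfl⟩))
  have hz1 : z 1 ∈ adjoin ℚ (SFset z ∪ {I}) := subset_adjoin ℚ _ (Or.inl (Or.inl ⟨1, rfl⟩))
  have hz2 : z 2 ∈ adjoin ℚ (SFset z ∪ {I}) := subset_adjoin ℚ _ (Or.inl (Or.inl ⟨2, rfl⟩))
  have hz3 : z 3 ∈ adjoin ℚ (SFset z ∪ {I}) := subset_adjoin ℚ _ (Or.inl (Or.inl ⟨3, rfl⟩))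
  have ez0 : z 0 = (Real.pi : ℂ) := rfl
  have ez1 : z 1 = (Real.pi : ℂ) * ((liouvilleNumber 2 : ℝ) : ℂ) := rfl
  have ez2 : z 2 = (Real.pi : ℂ) * ((liouvilleNumber 3 : ℝ) : ℂ) := rfl
  have ez3 : z 3 = (Real.pi : ℂ) * (ρ : ℂ) := rfl
  have eρ : (ρ : ℂ) = z 3 / z 0 := by rw [ez3, ez0, mul_div_cancel_left₀ _ hπ0]
  have eℓ₂ : ((liouvilleNumber 2 : ℝ) : ℂ) = z 1 / z 0 := by rw [ez1, ez0, mul_div_cancel_left₀ _ hπ0]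
  have eℓ₃ : ((liouvilleNumber 3 : ℝ) : ℂ) = z 2 / z 0 := by rw [ez2, ez0, mul_div_cancel_left₀ _ hπ0]
  refine sb_of_logHyperLiouville_of_logPowMeasure (n := 3) hρ ?_ logPowMeasure_two_three_pi ?_
  · rw [eρ]; exact div_mem hz3 hz0
  · intro j
    fin_cases j
    · show ((liouvilleNumber 2 : ℝ) : ℂ) ∈ _
      rw [eℓ₂]; exact div_mem hz1 hz0
    · show ((liouvilleNumber 3 : ℝ) : ℂ) ∈ _
      rw [eℓ₃]; exact div_mem hz2 hz0
    · show (Real.pi : ℂ) ∈ _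
      exact hz0

/-- **ITEM 33364 ON THE MEASURED WALL CELL (e-version, mod `hNW`).** Binders of
`Summit.Schanuel.Schanuel.Theses.RootDecomp1K.FiniteOrderLiouvilleSchanuel` VERBATIM, with ONE line inserted
after `LinearIndependent ℚ z` — the cell `Set.range z = Set.range (1, ℓ₂, ℓ₃, ρ)`, `ρ` ranging over the
LOG-HYPER-LIOUVILLE reals (outer parameters `ρ`, `hρ`: CLASS DATA ONLY, no digit pattern of `ρ` enters). The two
Diophantine hypotheses are not used by the proof (the conclusion holds outright on the cell); they are CERTIFIED
at the member `z_M` (§6). -/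
theorem finiteOrderLiouvilleSchanuel_measuredWallCell (hNW : NWMeasure) {ρ : ℝ}
    (hρ : LogHyperLiouville ρ) :
    ∀ (n : ℕ) (z : Fin n → ℂ), LinearIndependent ℚ z →
      Set.range z = Set.range ![(1 : ℂ), ((liouvilleNumber 2 : ℝ) : ℂ), ((liouvilleNumber 3 : ℝ) : ℂ),
        (ρ : ℂ)] →
      (∀ ω : ℕ, ∃ h : Fin n → ℤ, h ≠ 0 ∧ ‖∑ i, (h i : ℂ) * z i‖ < 1 / (1 + ∑ i, (|h i| : ℝ)) ^ ω) →
      (¬ ∀ m : ℕ, ∃ h : Fin n → ℤ, h ≠ 0 ∧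
        ‖∑ i, (h i : ℂ) * z i‖ < Real.exp (-((1 + ∑ i, (|h i| : ℝ)) ^ m))) →
      (n : Cardinal) ≤ Algebra.trdeg ℚ
        ↥(IntermediateField.adjoin ℚ (Set.range z ∪ Set.range (Complex.exp ∘ z))) := by
  intro n z hz hrange _ _
  exact sb_of_range_eq' hz.injective hrange (sb_measuredWallCell hNW hρ)

/-- **ITEM 33364 ON THE MEASURED WALL CELL, π-version — HYPOTHESIS-FREE.** Same binders verbatim, the cell line
`Set.range z = Set.range (π, πℓ₂, πℓ₃, πρ)`, `ρ` log-hyper-Liouville. -/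
theorem finiteOrderLiouvilleSchanuel_measuredWallCell_pi {ρ : ℝ} (hρ : LogHyperLiouville ρ) :
    ∀ (n : ℕ) (z : Fin n → ℂ), LinearIndependent ℚ z →
      Set.range z = Set.range ![(Real.pi : ℂ), (Real.pi : ℂ) * ((liouvilleNumber 2 : ℝ) : ℂ),
        (Real.pi : ℂ) * ((liouvilleNumber 3 : ℝ) : ℂ), (Real.pi : ℂ) * (ρ : ℂ)] →
      (∀ ω : ℕ, ∃ h : Fin n → ℤ, h ≠ 0 ∧ ‖∑ i, (h i : ℂ) * z i‖ < 1 / (1 + ∑ i, (|h i| : ℝ)) ^ ω) →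
      (¬ ∀ m : ℕ, ∃ h : Fin n → ℤ, h ≠ 0 ∧
        ‖∑ i, (h i : ℂ) * z i‖ < Real.exp (-((1 + ∑ i, (|h i| : ℝ)) ^ m))) →
      (n : Cardinal) ≤ Algebra.trdeg ℚ
        ↥(IntermediateField.adjoin ℚ (Set.range z ∪ Set.range (Complex.exp ∘ z))) := by
  intro n z hz hrange _ _
  exact sb_of_range_eq' hz.injective hrange (sb_measuredWallCell_pi hρ)

/-- The measured wall CLASS: `z` is a re-indexing of `(1, ℓ₂, ℓ₃, ρ)` for SOME log-hyper-Liouville real `ρ`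
(class data only). -/
def InMeasuredWallClass {n : ℕ} (z : Fin n → ℂ) : Prop :=
  ∃ ρ : ℝ, LogHyperLiouville ρ ∧
    Set.range z = Set.range ![(1 : ℂ), ((liouvilleNumber 2 : ℝ) : ℂ), ((liouvilleNumber 3 : ℝ) : ℂ), (ρ : ℂ)]

/-- The π-twin class. -/
def InMeasuredWallClassPi {n : ℕ} (z : Fin n → ℂ) : Prop :=
  ∃ ρ : ℝ, LogHyperLiouville ρ ∧
    Set.range z = Set.range ![(Real.pi : ℂ), (Real.pi : ℂ) * ((liouvilleNumber 2 : ℝ) : ℂ),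
      (Real.pi : ℂ) * ((liouvilleNumber 3 : ℝ) : ℂ), (Real.pi : ℂ) * (ρ : ℂ)]

/-- **ITEM 33364 ON THE MEASURED WALL CLASS (mod `hNW`)** — binders verbatim + the ONE class line
`InMeasuredWallClass z`. -/
theorem finiteOrderLiouvilleSchanuel_of_inMeasuredWallClass (hNW : NWMeasure) :
    ∀ (n : ℕ) (z : Fin n → ℂ), LinearIndependent ℚ z → InMeasuredWallClass z →
      (∀ ω : ℕ, ∃ h : Fin n → ℤ, h ≠ 0 ∧ ‖∑ i, (h i : ℂ) * z i‖ < 1 / (1 + ∑ i, (|h i| : ℝ)) ^ ω) →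
      (¬ ∀ m : ℕ, ∃ h : Fin n → ℤ, h ≠ 0 ∧
        ‖∑ i, (h i : ℂ) * z i‖ < Real.exp (-((1 + ∑ i, (|h i| : ℝ)) ^ m))) →
      (n : Cardinal) ≤ Algebra.trdeg ℚ
        ↥(IntermediateField.adjoin ℚ (Set.range z ∪ Set.range (Complex.exp ∘ z))) := by
  rintro n z hz ⟨ρ, hρ, hrange⟩ hω hm
  exact finiteOrderLiouvilleSchanuel_measuredWallCell hNW hρ n z hz hrange hω hm

/-- **ITEM 33364 ON THE MEASURED WALL π-CLASS — HYPOTHESIS-FREE.** -/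
theorem finiteOrderLiouvilleSchanuel_of_inMeasuredWallClassPi :
    ∀ (n : ℕ) (z : Fin n → ℂ), LinearIndependent ℚ z → InMeasuredWallClassPi z →
      (∀ ω : ℕ, ∃ h : Fin n → ℤ, h ≠ 0 ∧ ‖∑ i, (h i : ℂ) * z i‖ < 1 / (1 + ∑ i, (|h i| : ℝ)) ^ ω) →
      (¬ ∀ m : ℕ, ∃ h : Fin n → ℤ, h ≠ 0 ∧
        ‖∑ i, (h i : ℂ) * z i‖ < Real.exp (-((1 + ∑ i, (|h i| : ℝ)) ^ m))) →
      (n : Cardinal) ≤ Algebra.trdeg ℚ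
        ↥(IntermediateField.adjoin ℚ (Set.range z ∪ Set.range (Complex.exp ∘ z))) := by
  rintro n z hz ⟨ρ, hρ, hrange⟩ hω hm
  exact finiteOrderLiouvilleSchanuel_measuredWallCell_pi hρ n z hz hrange hω hm

end Cells

end Summit.Schanuel.Schanuel.Theorems.RootDecomp1KMeasuredWallCell

end
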